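import Summits.AtomisticToContinuum.HydrodynamicLimit.Theorems.LambertianContactSwapSwapGapRelEntSwapTimeZero
import Summits.AtomisticToContinuum.HydrodynamicLimit.Theorems.LambertianContactSwapSwapGapEntropyTools
import HarnessLib

/-!
# `SwapGap` (stmt-AtomisticToContinuum-11850), line `Sketch`, stub `stub_echoMeanReturn_zero` (T19):
# the echo mean return is exact at `t = 0`

Rung T19 of v12 §12 (the reversed entropy line) of line `Sketch` for the crux
`Summit.AtomisticToContinuum.HydrodynamicLimit.Theses.LambertianContactSwap.SwapGap`.
With `P_N = localGibbsLaw σ a₀ u₀ θ₀ N Φ`, `G_N = localGibbsLaw σ 1 0 1 N Φ` and the additive statistic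
`L_N = llr P_N G_N`, the reversed decomposition reads
`KL(q_t ‖ p_t) + [KL(P_N ‖ G_N) − KL(q_t ‖ G_N)] = ∫ L_N dP_N − ∫ L_N(Φ_{-t}(Λ_t p)) d(P_N ⊗ γ^ℕ)`;
the research stub `stub_echoMeanReturn` asserts that this ECHO DEFICIT is `o(N)` pre-shock.  Here:
at `t = 0` it is EXACTLY `0`, for `0 < σ < 1/2`, continuous positive profiles, every `N` and every flow.

Mechanism: `Λ_0 p = p.1` for `P_N ⊗ γ^ℕ`-a.e. `p` (`ae_lambertFlow_zero_eq`, as `P_N ≪ Liouville`);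
`Φ_{-0} = Φ_0 = id` on the good set (`neg_zero`, `HardSphereFlow.flow_zero`), which carries `P_N`
(`measure_compl_good_eq_zero_of_absolutelyContinuous`) and hence `P_N ⊗ γ^ℕ` in the first coordinate
(`Measure.quasiMeasurePreserving_fst`); so the echo integrand is a.s. `L_N(p.1)`, and
`∫ L_N(p.1) d(P_N ⊗ γ^ℕ) = ∫ L_N dP_N` because `γ^ℕ` is a probability measure (`Measure.map_fst_prod`,
`integral_map`).

prover-line-stmt-AtomisticToContinuum-11850-c6-0, cycle 7 (stub worker T19).
-/

noncomputable section

open MeasureTheory Filter Set Topology InformationTheory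
open scoped ENNReal

namespace Summit.AtomisticToContinuum.HydrodynamicLimit.Theorems

open Literature.Analysis.FluidPDE Literature.MathematicalPhysics.KineticTheory

/-- **T19 · ECHO MEAN RETURN HOLDS EXACTLY AT `t = 0`** (rung of the research stub `stub_echoMeanReturn`
of line `Sketch`, v12 §12): for `0 < σ < 1/2`, continuous positive profiles, every `N` and every flow,
the `t = 0` echo deficit `∫ L_N dP_N − ∫ L_N(Φ_{-0}(Λ_0 p)) d(P_N ⊗ γ^ℕ)` vanishes, where
`L_N = llr P_N G_N`: `Λ_0 = id` almost surely under `P_N ⊗ γ^ℕ` (`ae_lambertFlow_zero_eq`, `P_N ≪ liouville`),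
`Φ_{-0} = Φ_0 = id` on the good set (`HardSphereFlow.flow_zero`), which carries `P_N`
(`measure_compl_good_eq_zero_of_absolutelyContinuous`), so the echo integrand is a.s. `L_N(p.1)` and
`∫ L_N(p.1) d(P_N ⊗ γ^ℕ) = ∫ L_N dP_N` (`γ^ℕ` is a probability measure; `integral_map` of `Prod.fst`).
[folklore] -/
theorem stub_echoMeanReturn_zero :
    ∀ (a₀ θ₀ : T3 → ℝ) (u₀ : T3 → V3), Continuous a₀ → Continuous θ₀ → Continuous u₀ →
      (∀ x, 0 < a₀ x) → (∀ x, 0 < θ₀ x) → ∀ σ : ℝ, 0 < σ → σ < 2⁻¹ →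
        ∀ (N : ℕ) (Φ : HardSphereFlow (Torus.geometry (Fin 3)) (hsDiameter σ N) (N + 1)),
          (∫ z, llr (localGibbsLaw σ a₀ u₀ θ₀ N Φ)
              (localGibbsLaw σ (fun _ => 1) (fun _ => 0) (fun _ => 1) N Φ) z ∂(localGibbsLaw σ a₀ u₀ θ₀ N Φ)) -
            ∫ p, llr (localGibbsLaw σ a₀ u₀ θ₀ N Φ)
              (localGibbsLaw σ (fun _ => 1) (fun _ => 0) (fun _ => 1) N Φ)
              (Φ.flow (-0) (lambertFlow (Torus.geometry (Fin 3)) (hsDiameter σ N) p.2 p.1 0))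
              ∂((localGibbsLaw σ a₀ u₀ θ₀ N Φ).prod (lambertNoise (Fin 3))) = 0 := by
  intro a₀ θ₀ u₀ ha hθ hu ha0 hθ0 σ hσ hσ' N Φ
  haveI := isProbabilityMeasure_localGibbsLaw ha hθ hu ha0 hθ0 (by linarith : σ ≤ 1 / 2) N Φ
  set P := localGibbsLaw σ a₀ u₀ θ₀ N Φ with hPdef
  set L := llr P (localGibbsLaw σ (fun _ => 1) (fun _ => 0) (fun _ => 1) N Φ)
  have hLm : Measurable L := measurable_llr _ _
  -- `P_N ≪ Liouville`
  have hP : P ≪ liouville (Torus.geometry (Fin 3)) (N + 1) (hsDiameter σ N) := by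
    rw [hPdef, localGibbsLaw, particleLaw_eq]
    exact withDensity_absolutelyContinuous _ _
  have hε : 0 < hsDiameter σ N := hsDiameter_pos hσ N
  have hε' : hsDiameter σ N < 2⁻¹ := (hsDiameter_le hσ.le N).trans_lt hσ'
  -- `Λ_0 p = p.1` almost surely
  have h1 : ∀ᵐ p ∂(P.prod (lambertNoise (Fin 3))),
      lambertFlow (Torus.geometry (Fin 3)) (hsDiameter σ N) p.2 p.1 0 = p.1 :=
    ae_lambertFlow_zero_eq hε hε' P hP
  -- `P_N`-a.e. configuration is good, hence so is the first coordinate under `P_N ⊗ γ^ℕ`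
  have hgood : ∀ᵐ z ∂P, z ∈ Φ.good := by
    rw [ae_iff]
    exact measure_compl_good_eq_zero_of_absolutelyContinuous Φ hP
  have h2 : ∀ᵐ p ∂(P.prod (lambertNoise (Fin 3))), p.1 ∈ Φ.good :=
    (Measure.quasiMeasurePreserving_fst (μ := P) (ν := lambertNoise (Fin 3))).ae hgood
  -- the echo integrand is a.s. `L (p.1)`
  have hae : (fun p : Config (N + 1) (Fin 3) T3 × (ℕ → EuclideanSpace ℝ (Fin 3)) =>
      L (Φ.flow (-0) (lambertFlow (Torus.geometry (Fin 3)) (hsDiameter σ N) p.2 p.1 0))) =ᵐ[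
        P.prod (lambertNoise (Fin 3))] fun p => L p.1 := by
    filter_upwards [h1, h2] with p hp1 hp2
    rw [hp1, neg_zero, Φ.flow_zero _ hp2]
  rw [integral_congr_ae hae]
  -- marginalise the probability noise
  have hmap : (P.prod (lambertNoise (Fin 3))).map Prod.fst = P := by
    rw [Measure.map_fst_prod, measure_univ, one_smul]
  have hint : ∫ p, L p.1 ∂(P.prod (lambertNoise (Fin 3))) = ∫ z, L z ∂P :=
    calc ∫ p, L p.1 ∂(P.prod (lambertNoise (Fin 3)))
          = ∫ z, L z ∂((P.prod (lambertNoise (Fin 3))).map Prod.fst) :=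
            (integral_map measurable_fst.aemeasurable hLm.aestronglyMeasurable).symm
      _ = ∫ z, L z ∂P := by rw [hmap]
  rw [hint, sub_self]

end Summit.AtomisticToContinuum.HydrodynamicLimit.Theorems

end
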